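import Mathlib
import Summits.CriticalPhenomena.CardyFormulaZ2.Theorems.CardySelfRefinementDefs
import Summits.CriticalPhenomena.CardyFormulaZ2.Theorems.CardySelfRefinementGradientComparabilityStubCornerWindowsPatterns
import HarnessLib

/-!
# Crux `GradientComparability` (stmt-CriticalPhenomena-10269), line `monotone-product-coordinates` —
# support for stub `stub_cornerWindows`, part 7: the slope bound in pivotal currency (D1∇) on the
# enhancement slice `ρ = 1` from the local corner slope bound (LOC) and the confinement of the band (D1c)

Route `CardySelfRefinement`, sub-problem `CriticalPhenomena/CardyFormulaZ2`; vocabulary from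
`CardySelfRefinementDefs` (`ax tb M Aloc P Dc Dρ window coinWindow edgeOf`); part 2
(`…StubCornerWindowsPatterns`: `abs_Drho_le_sum_bundlePivotal`, `|∂ρP| ≤ (½ − 2^{-k}) N`).

## Mathematics

Write `N(1,c) = Σ_B M_k(1,c)(B set-pivotal for Aloc)` for the bundle-pivotal mass of the window (the sum
over the selector coins `i` of the coin window, `i.2.2 = 2`, of the canonical bundle events, as in parts
2–6).  Hypothesis (D1∇) of `farDefectSmall_rho1_of_cRange_of_DcBound` (part 6) asks, on the band
`{c ∈ [0,1] : P(1,c) ∈ [vlo,vhi]}` of the slice `ρ = 1` and for small mesh, `∂cP(1,c) ≤ C · N(1,c)`.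
It is the local corner slope bound (LOC) = `stub_cornerLocalSlope` (`|∂cP| ≤ C |∂ρP|` for
`ρ ∈ [1 − 2δ, 1]`, `c ≤ c₀`, band points, mesh `η < η₁`) read at `ρ = 1`:

* (D1c) (`cRange_rho1_of_cornerConfinement`, part 6) with `ε := c₀` puts every band point of the
  slice at `c ≤ c₀` once `η < η₁(c₀)`;
* (LOC) at `ρ = 1 ∈ [1 − 2δ, 1]` then gives `|∂cP(1,c)| ≤ C |∂ρP(1,c)|`;
* `abs_Drho_le_sum_bundlePivotal` (part 2) gives `|∂ρP(1,c)| ≤ (½ − 2^{-k}) N(1,c)`;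

so `∂cP(1,c) ≤ |∂cP(1,c)| ≤ C₊ (½ − 2^{-k}) N(1,c)` with `C₊ = max C 0`, for `η < min η₁ η₁(c₀)`.
The quantifier shapes compose: (LOC) produces its own `δ, c₀` BEFORE the level band is fixed and
(D1c) holds for EVERY `ε > 0`, so it is invoked with that `c₀`.  Pure bookkeeping; no percolation
estimate and no named fact is used.  With part 6 this closes the wiring
`(D1) ⟸ (D1∂) + (CONF) + (LOC)` of hypothesis (D1) of `cornerWindow_rho1_of_pivotalWindow_of_defectBound`.
-/

noncomputable section

namespace Summit.CriticalPhenomena.CardyFormulaZ2.Theorems.CardySelfRefinement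

open scoped Topology
open Filter Set MeasureTheory
open Literature.Probability.LatticeModels Literature.Probability.Percolation
open Literature.Probability.Percolation.QuadCrossing
open Summit.CriticalPhenomena.CardyFormulaZ2.Theses.CardySelfRefinement

/-- **(LOC) ⟹ (D1c) ⟹ (D1∇)** (registered helper of `stub_cornerWindows`, wave 6): on the band of the
enhancement slice `ρ = 1`, `∂cP(1,c) ≤ C · Σ_B M_k(1,c)(B set-pivotal)` for small mesh — from the local
corner slope bound (LOC) = `stub_cornerLocalSlope` (taken verbatim as the first hypothesis) at `ρ = 1`,
the confinement (D1c) of the band into `c ≤ c₀` (second hypothesis, invoked with `ε := c₀` of (LOC)) and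
`abs_Drho_le_sum_bundlePivotal` (`|∂ρP| ≤ (½ − 2^{-k}) N`); constant `max C 0 · (½ − 2^{-k})`. -/
theorem DcBound_rho1_of_cornerLocalSlope_of_cRange : (∀ k : ℕ, k = 2 ∨ k = 3 → ∀ (m : ℕ) (F : Fin m → Quad (Set.univ : Set ℂ)), 0 < m → ∃ δ c₀ : ℝ, 0 < δ ∧ 0 < c₀ ∧ ∀ vlo vhi : ℝ, 0 < vlo → vlo < vhi → vhi < 1 → ∃ C η₁ : ℝ, 0 < η₁ ∧ ∀ η ∈ Set.Ioo 0 η₁, ∀ ρ ∈ Set.Icc (1 - 2 * δ) 1, ∀ c ∈ Set.Icc (0 : ℝ) c₀, P k m F η ρ c ∈ Set.Icc vlo vhi → |Dc k m F η (ρ, c)| ≤ C * |Dρ k m F η (ρ, c)|) → (∀ k : ℕ, k = 2 ∨ k = 3 → ∀ (m : ℕ) (F : Fin m → Quad (Set.univ : Set ℂ)), 0 < m → ∀ vlo vhi : ℝ, 0 < vlo → vlo < vhi → vhi < 1 → ∀ ε : ℝ, 0 < ε → ∃ η₁ : ℝ, 0 < η₁ ∧ ∀ η ∈ Set.Ioo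 0 η₁, ∀ c ∈ Set.Icc (0 : ℝ) 1, P k m F η 1 c ∈ Set.Icc vlo vhi → c ≤ ε) → ∀ k : ℕ, k = 2 ∨ k = 3 → ∀ (m : ℕ) (F : Fin m → Quad (Set.univ : Set ℂ)), 0 < m → ∀ vlo vhi : ℝ, 0 < vlo → vlo < vhi → vhi < 1 → ∃ C η₁ : ℝ, 0 < η₁ ∧ ∀ η ∈ Set.Ioo 0 η₁, ∀ K : Finset (Site 2 × Fin 2 × Fin 3), (↑K : Set (Site 2 × Fin 2 × Fin 3)) = coinWindow k (window m F η) → ∀ c ∈ Set.Icc (0 : ℝ) 1, P k m F η 1 c ∈ Set.Icc vlo vhi → Dc k m F η (1, c) ≤ C * ∑ i ∈ K with i.2.2 = 2, (M k 1 c).real {ω | ω ∪ edgeOf '' {vd : Site 2 × Fin 2 | ax k vd ∧ tb k vd = i.1 ∧ vd.2 = i.2.1} ∈ Aloc m F η ∧ ω \ edgeOf '' {vd : Site 2 × Fin 2 | ax k vd ∧ tb k vd = i.1 ∧ vd.2 = i.2.1} ∉ Aloc m F η} := by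
  intro HL HC k hk m F hm vlo vhi hvlo hvv hvhi
  have hkpos : 0 < k := by rcases hk with rfl | rfl <;> norm_num
  obtain ⟨δ, c₀, hδ, hc₀, HLv⟩ := HL k hk m F hm
  obtain ⟨C, ηL, hηL, HLη⟩ := HLv vlo vhi hvlo hvv hvhi
  obtain ⟨ηC, hηC, HCη⟩ := HC k hk m F hm vlo vhi hvlo hvv hvhi c₀ hc₀
  refine ⟨max C 0 * (1 / 2 - (1 / 2) ^ k), min ηL ηC, lt_min hηL hηC, fun η hη K hK c hc hband => ?_⟩
  have hη0 : 0 < η := hη.1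
  have hηL' : η ∈ Set.Ioo 0 ηL := ⟨hη0, hη.2.trans_le (min_le_left _ _)⟩
  have hηC' : η ∈ Set.Ioo 0 ηC := ⟨hη0, hη.2.trans_le (min_le_right _ _)⟩
  -- the band point sits in the corner chart of (LOC)
  have hcc₀ : c ≤ c₀ := HCη η hηC' c hc hband
  have h1 : (1 : ℝ) ∈ Set.Icc (1 - 2 * δ) 1 := ⟨by linarith, le_rfl⟩
  have hloc : |Dc k m F η (1, c)| ≤ C * |Dρ k m F η (1, c)| := HLη η hηL' 1 h1 c ⟨hc.1, hcc₀⟩ hband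
  -- `|∂ρP(1,c)| ≤ (½ − 2^{-k}) N(1,c)`
  have hrho := abs_Drho_le_sum_bundlePivotal k m hkpos F hη0.ne' (ρ := 1) ⟨zero_le_one, le_rfl⟩ c K hK
  have habs : 0 ≤ |Dρ k m F η (1, c)| := abs_nonneg _
  calc Dc k m F η (1, c) ≤ |Dc k m F η (1, c)| := le_abs_self _
    _ ≤ C * |Dρ k m F η (1, c)| := hloc
    _ ≤ max C 0 * |Dρ k m F η (1, c)| := mul_le_mul_of_nonneg_right (le_max_left _ _) habs
    _ ≤ max C 0 * ((1 / 2 - (1 / 2) ^ k) * _) := mul_le_mul_of_nonneg_left hrho (le_max_right _ _)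
    _ = max C 0 * (1 / 2 - (1 / 2) ^ k) * _ := (mul_assoc _ _ _).symm

end Summit.CriticalPhenomena.CardyFormulaZ2.Theorems.CardySelfRefinement

end
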